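import Literature.MathematicalPhysics.QuantumFieldTheory.Balaban1983to89.B5Eq194DivG
import Literature.MathematicalPhysics.QuantumFieldTheory.Balaban1983to89.B5QGQ171Unit

/-!
# `Balaban1983to89.B5Eq199QGQTorus` — T. Bałaban, *Propagators and renormalization transformations for
# lattice gauge theories. I*, Commun. Math. Phys. **95** (1984) 17–40 [Balaban1984PropagatorsI]:
# the formula (1.99) for `QGQ*` and the two-sided bound (1.100), PROVED in position space for the
# concrete torus operators (`G = Δ_a⁻¹`, `φ` the Sect. E operator (1.76))

statement-level skeleton of published theorems with citation tags; proofs where landed; nothing here is a claim about the Yang–Mills mass gap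

PDF held: `paper:balaban1984-cmp95-propagators-rt-i` (journal page = PDF page + 16); p. 34 read this session
from the page render `1984-cmp95-propagators-rt-I-p018-x4.png` (not from OCR).  Docstring v1.1 (second reader
r05 pass 27 (b)): the docstring of `GPhiEInv_posSemidef` now quotes p. 31 L3–5 verbatim (the v1.0 guillemets held a
paraphrase located on p. 30); declarations byte-identical.

WHAT IS REPRODUCED.  SKELETON row **B5.Eq1.101** (members (1.99), (1.100)) of
`run/shared/lean/pub/lit-balaban/SKELETON.md` — so far «proved-existing» PER FIBRE `p′ ≠ 0` on the unit
lattice at `U = 1` (`B5QGQ199Rate.qgq_eq_Emat`, `ineq1100_lower/upper`); this file gives the OPERATOR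
statements on the torus `T₁^{(k)} = Tor M` for `G = (B5DeltaA169.DeltaA n M a)⁻¹`.  Phase-2 seat **p37**
(gen 3, third target) of `PHASE2-TARGETS.md` §G (cell `lit-balaban`, unit `lit-balaban-p37`, HOME
`run/shared/lean/pub/lit-balaban/`).  Kind «model-instance / identity + inequality».

## The printed text (p. 34; verbatim)

«We have to satisfy yet the condition QA = B, so we have to investigate the operator QGQ*. It is given by
the formula
  QGQ* = a⁻¹I − a⁻¹φ⁻¹ + a⁻¹φ⁻¹∂₁(∂₁*φ⁻¹∂₁)⁻¹∂₁*φ⁻¹,   (1.99)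
and can be bounded as follows
  a⁻¹(φ − 1)φ⁻¹ ≤ QGQ* ≤ a⁻¹I.   (1.100)»
(`φ = I + aQΔ⁻¹Q*` (1.76), p. 30: «a well-defined and positive operator on the subspace of vector functions
defined on the unit lattice T₁^{(k)} and orthogonal to constant functions»; p. 33: the computation is made
«on configurations orthogonal to constant configurations»; (1.82) p. 31: `GJ = GJ′ + a⁻¹J₀`.)

## Dictionary

As in `B5Eq194DivG`/`B5Phi176Torus`: `Q = QvOp n M`, `Q* = QvAdj n M` (`= n^d·Qᴴ`, the (1.21) adjoint),
`G = (DeltaA n M a)⁻¹`, `φ = Phi176 n M a`, `φ⁻¹ = Phi176Inv n M a`, `∂₁ = GradOp M 1`,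
`(∂₁*φ⁻¹∂₁)⁻¹ = GPhiEInv n M a` (on `1^⊥`), `B₀ = B5Hk160Torus.B0` / `P₀ = B5Hk160Torus.P0M` (the
projection onto constant configurations, p. 27), `B′ = Bp`.  `≤` in (1.100) is the Löwner order of the
`ℓ²(T₁^{(k)}; ℂ^d)` forms (Mathlib `Matrix.PosSemidef` of the difference) — the unit-lattice scalar product
(1.21) is the plain sum, `B5Lagrange149Torus.ipC`.

## What is certified (kernel, zero `sorry`, axioms ⊆ {propext, Classical.choice, Quot.sound})

* §2 **(1.99)** on `ω ⊥` constants verbatim (`eq199_mulVec_of_orth`), by the printed road: `A = GQ*ω` solves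
  `Δ_aA = Q*ω`, so (1.77) `QA = φ⁻¹∂₁u + φ⁻¹QΔ⁻¹Q*ω` with `u = Q′Δ⁻¹∂*A = a⁻¹(∂₁*φ⁻¹∂₁)⁻¹∂₁*φ⁻¹ω` by (1.80)
  (`B5Eq194DivG.eq177`, `eq180_QvAdj`), and `φ⁻¹QΔ⁻¹Q* = a⁻¹(I − φ⁻¹)` by (1.76); on constants
  `QGQ*c = a⁻¹c` ((1.82); `QGQ_constV`); hence on ALL of `ℓ²(T₁^{(k)}; ℂ^d)`:
  `QGQ*ω = a⁻¹ω − a⁻¹φ⁻¹ω′ + a⁻¹φ⁻¹∂₁(∂₁*φ⁻¹∂₁)⁻¹∂₁*φ⁻¹ω` (`eq199_mulVec`) and the matrix identity `eq199`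
  with the printed `φ⁻¹` read as `φ⁻¹(I − P₀)` (the inverse OF THE SUBSPACE operator φ of (1.76), extended
  by `0` to the constants — the reading that makes (1.99) hold on the whole space; on `1^⊥` it is verbatim).
* §3 **(1.100)**: `QGQ* ≤ a⁻¹I` (`ineq1100_upper`, the Löwner form of `B5QGQ171Unit`'s `a − a²QGQ* ⪰ 0`, via
  the bridge `QGQ_eq_covB : Q(Δ_a)⁻¹Q* = covB`) and `a⁻¹(φ − 1)φ⁻¹ ≤ QGQ*` (`ineq1100_lower`), the latter AS
  PRINTED suggests: `QGQ* − a⁻¹(φ − 1)φ⁻¹ = a⁻¹P₀ + a⁻¹(∂₁*φ⁻¹)ᴴ(∂₁*φ⁻¹∂₁)⁻¹(∂₁*φ⁻¹)` (`QGQ_sub_lower_eq`) is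
  a sum of two positive semidefinite operators (`P0M_posSemidef`, `GPhiEInv_posSemidef`,
  `Phi176Inv_isHermitian`).  This file declares no `def`: theorems only.

HONEST SCOPE.  Finite torus (periods `n·M_μ`), complex fields, `n ≥ 1`, any `d`, `a > 0`; (1.101) (the momentum
representation of `a⁻¹(φ − 1)/φ` and its two-sided bounds) is NOT restated here — it is `B5QGQ199Rate.m101*`
per fibre.  NOT summit progress.
-/

open scoped BigOperators Matrix ComplexConjugate ComplexOrder
open Finset Complex

namespace Literature.MathematicalPhysics.QuantumFieldTheory.Balaban1983to89.B5Eq199QGQTorus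

open Literature.MathematicalPhysics.QuantumFieldTheory.Balaban1983to89
open Literature.MathematicalPhysics.QuantumFieldTheory.Balaban1983to89.B5Prop11Plancherel (Tor dft fine)
open Literature.MathematicalPhysics.QuantumFieldTheory.Balaban1983to89.B5Prop11Lower (exists_gram
  smul_gram_posSemidef)
open Literature.MathematicalPhysics.QuantumFieldTheory.Balaban1983to89.B5Action121 (GradOp)
open Literature.MathematicalPhysics.QuantumFieldTheory.Balaban1983to89.B5Block118 (QsOp QvOp)
open Literature.MathematicalPhysics.QuantumFieldTheory.Balaban1983to89.B5LaplaceInverse (ssym LapSinv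
  dft_mul_conjTranspose)
open Literature.MathematicalPhysics.QuantumFieldTheory.Balaban1983to89.B5DeltaA169 (QvAdj DeltaA isUnit_DeltaA
  calG_eq_DeltaA_inv)
open Literature.MathematicalPhysics.QuantumFieldTheory.Balaban1983to89.B5Phi162Torus (liftV OrthConst cMul
  LapVinv PhiOp PhiOp_mulVec)
open Literature.MathematicalPhysics.QuantumFieldTheory.Balaban1983to89.B5Hk160Torus (sMul constV divS_constV
  QvAdj_constV QvOp_constV orthConst_QvAdj B0 Bp orthConst_Bp Bp_add_B0 P0M P0M_mulVec)
open Literature.MathematicalPhysics.QuantumFieldTheory.Balaban1983to89.B5Phi176Torus (Phi176 phi184 phi184_pos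
  Phi176Inv Phi176_mul_Phi176Inv Phi176Inv_eq_sub Phi176Inv_constV GPhiE gsymE gsymE_eq_ofReal GPhiEInv
  orthConst_of_DeltaA_eq G_constV)
open Literature.MathematicalPhysics.QuantumFieldTheory.Balaban1983to89.B5Eq194DivG (eq177 eq180_QvAdj)
open Literature.MathematicalPhysics.QuantumFieldTheory.Balaban1983to89.Beta.VectorPropagatorDict
  (ext_of_mulVec')
open Literature.MathematicalPhysics.QuantumFieldTheory.Balaban1983to89.B5QGQ171Unit (covB effOp
  effOp_posSemidef covB_isHermitian)

noncomputable section

/-! ## §1 Tools: adjoints of the momentum multipliers, real scalings of `⪰ 0` -/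

section Tools

variable {d : ℕ} (N : Fin d → ℕ) [hN : ∀ ν, NeZero (N ν)]

omit hN in
/-- `(liftV L)ᴴ = liftV (Lᴴ)` (componentwise operators). [folklore] -/
private theorem liftV_conjTranspose (L : Fin d → Matrix (Tor N) (Tor N) ℂ) :
    (liftV N L)ᴴ = liftV N fun μ => (L μ)ᴴ := by
  ext i j
  simp only [liftV, Matrix.conjTranspose_apply]
  by_cases h : i.2 = j.2
  · rw [if_pos h, if_pos h.symm, h]
  · rw [if_neg h, if_neg (Ne.symm h), star_zero]

/-- `(cMul m)ᴴ = cMul (m̄)`: a Fourier multiplier's adjoint is the conjugate multiplier. [folklore] -/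
private theorem cMul_conjTranspose (m : Fin d → Tor N → ℂ) :
    (cMul N m)ᴴ = cMul N fun μ => star (m μ) := by
  rw [cMul, liftV_conjTranspose]
  unfold cMul
  congr 1
  funext μ
  rw [Matrix.conjTranspose_mul, Matrix.conjTranspose_mul, Matrix.conjTranspose_conjTranspose,
    Matrix.diagonal_conjTranspose, Matrix.mul_assoc]

/-- a scalar Fourier multiplier with non-negative symbol is `⪰ 0`. [folklore] -/
private theorem sMul_posSemidef {g : Tor N → ℂ} (hg : ∀ q, 0 ≤ g q) : (sMul N g).PosSemidef := by
  rw [sMul]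
  exact (Matrix.PosSemidef.diagonal fun q => hg q).conjTranspose_mul_mul_same (dft N)

/-- `r • X ⪰ 0` for real `r ≥ 0` and `X ⪰ 0`. [folklore] -/
private theorem posSemidef_real_smul {m : Type*} [Fintype m] [DecidableEq m] {X : Matrix m m ℂ}
    (hX : X.PosSemidef) {r : ℝ} (hr : 0 ≤ r) : ((r : ℂ) • X).PosSemidef := by
  obtain ⟨B, hB⟩ := exists_gram hX
  rw [hB]
  exact smul_gram_posSemidef r hr B

/-- `P₀` is Hermitian. [cite: Balaban1984PropagatorsI, p.27 before (1.58)] -/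
theorem P0M_isHermitian : (P0M N).IsHermitian := by
  refine Matrix.IsHermitian.ext fun i j => ?_
  simp only [P0M]
  by_cases h : i.2 = j.2
  · rw [if_pos h, if_pos h.symm, star_inv₀, Complex.star_def, Complex.conj_natCast]
  · rw [if_neg h, if_neg (Ne.symm h), star_zero]

/-- `⟨B, P₀B⟩ = |T₁|⁻¹ Σ_μ |Σ_y B_μ(y)|²`: the form of the constant-mode projection. [folklore] -/
private theorem form_P0M (B : Tor N × Fin d → ℂ) :
    star B ⬝ᵥ (P0M N *ᵥ B)
      = ((Fintype.card (Tor N) : ℂ))⁻¹ * ∑ μ, star (∑ y, B (y, μ)) * ∑ y, B (y, μ) := by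
  rw [P0M_mulVec, dotProduct, Fintype.sum_prod_type, Finset.sum_comm, Finset.mul_sum]
  refine Finset.sum_congr rfl fun μ _ => ?_
  simp only [B0, constV, Pi.star_apply]
  rw [← Finset.sum_mul, star_sum]
  ring

/-- `P₀ ⪰ 0` (an orthogonal projection). [cite: Balaban1984PropagatorsI, p.27 before (1.58)] -/
theorem P0M_posSemidef : (P0M N).PosSemidef := by
  refine Matrix.PosSemidef.of_dotProduct_mulVec_nonneg (P0M_isHermitian N) fun B => ?_
  rw [form_P0M]
  have hc : (0 : ℂ) ≤ ((Fintype.card (Tor N) : ℂ))⁻¹ := by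
    rw [← Complex.ofReal_natCast, ← Complex.ofReal_inv]
    exact Complex.zero_le_real.mpr (inv_nonneg.mpr (Nat.cast_nonneg _))
  exact mul_nonneg hc (Finset.sum_nonneg fun μ _ => star_mul_self_nonneg _)

end Tools

section Main

variable {d : ℕ} (n : ℕ) [NeZero n] (M : Fin d → ℕ) [hM : ∀ μ, NeZero (M μ)] (a : ℝ)

omit [NeZero n] in
/-- `φ⁻¹` is Hermitian (a Fourier multiplier with the real symbol `1/φ_μ(p′)` of (1.84)).
[cite: Balaban1984PropagatorsI, (1.76) p.30, (1.84) p.31] -/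
theorem Phi176Inv_isHermitian : (Phi176Inv n M a).IsHermitian := by
  show (Phi176Inv n M a)ᴴ = Phi176Inv n M a
  rw [Phi176Inv, cMul_conjTranspose]
  congr 1
  funext μ q
  rw [Pi.star_apply, star_inv₀, Complex.star_def, Complex.conj_ofReal]

omit [NeZero n] in
/-- `(∂₁*φ⁻¹∂₁)⁻¹ ⪰ 0` (its symbol `(Σ_μ |∂₁,μ(p′)|²/φ_μ(p′))⁻¹` is `≥ 0`; p. 31 L3–5, after (1.79): «It is easy
to see that ∂*φ⁻¹∂₁ is positive also because φ⁻¹ is positive, so φ⁻¹ ≥ α > 0 and ∂*φ⁻¹∂₁ ≥ α∂*∂₁ = αΔ₀ > 0.» —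
hence its inverse on the subspace orthogonal to constant functions is positive (our reading; docstring v1.1, r05
pass 27 (b): the v1.0 words in guillemets here were a paraphrase, and were placed on p. 30).
[cite: Balaban1984PropagatorsI, p.31 L3–5 (after (1.79))] -/
theorem GPhiEInv_posSemidef (ha : 0 ≤ a) : (GPhiEInv n M a).PosSemidef := by
  rw [GPhiEInv]
  refine sMul_posSemidef M fun q => ?_
  rw [gsymE_eq_ofReal, ← Complex.ofReal_inv]
  exact Complex.zero_le_real.mpr (inv_nonneg.mpr (Finset.sum_nonneg fun μ _ =>
    mul_nonneg (sq_nonneg _) (inv_nonneg.mpr (phi184_pos n M a ha μ q).le)))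

/-! ## §2 (1.99): `QGQ*` -/

/-- `φ⁻¹QΔ⁻¹Q*ω = a⁻¹(ω − φ⁻¹ω)` (`aQΔ⁻¹Q* = φ − I`, (1.76); `a > 0`). [cite: Balaban1984PropagatorsI, (1.76) p.30] -/
theorem Phi176Inv_PhiOp_mulVec (ha : 0 < a) (ω : Tor M × Fin d → ℂ) :
    Phi176Inv n M a *ᵥ (PhiOp n M *ᵥ ω) = (a : ℂ)⁻¹ • (ω - Phi176Inv n M a *ᵥ ω) := by
  have ha' : (a : ℂ) ≠ 0 := by exact_mod_cast ha.ne'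
  have h := Phi176Inv_eq_sub n M a ha.le ω
  have h' : (a : ℂ) • (Phi176Inv n M a *ᵥ (PhiOp n M *ᵥ ω)) = ω - Phi176Inv n M a *ᵥ ω := by
    rw [h]; abel
  rw [← h', smul_smul, inv_mul_cancel₀ ha', one_smul]

/-- **(1.99) on `ω ⊥` constants, verbatim**: «QGQ* = a⁻¹I − a⁻¹φ⁻¹ + a⁻¹φ⁻¹∂₁(∂₁*φ⁻¹∂₁)⁻¹∂₁*φ⁻¹», by
the printed road — `A = GQ*ω` solves `Δ_aA = Q*ω` with `A ⊥ 1` ((1.74)), (1.77) gives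
`QA = φ⁻¹∂₁(Q′Δ⁻¹∂*A) + φ⁻¹QΔ⁻¹Q*ω`, (1.80) gives `Q′Δ⁻¹∂*A = a⁻¹(∂₁*φ⁻¹∂₁)⁻¹∂₁*φ⁻¹ω`, and
`φ⁻¹QΔ⁻¹Q* = a⁻¹(I − φ⁻¹)`. [cite: Balaban1984PropagatorsI, (1.99) p.34] -/
theorem eq199_mulVec_of_orth (ha : 0 < a) (ω : Tor M × Fin d → ℂ) (hω : OrthConst M ω) :
    QvOp n M *ᵥ ((DeltaA n M a)⁻¹ *ᵥ (QvAdj n M *ᵥ ω))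
      = (a : ℂ)⁻¹ • ω - (a : ℂ)⁻¹ • (Phi176Inv n M a *ᵥ ω)
        + (a : ℂ)⁻¹ • (Phi176Inv n M a *ᵥ (GradOp M 1 *ᵥ (GPhiEInv n M a *ᵥ
            ((GradOp M 1)ᴴ *ᵥ (Phi176Inv n M a *ᵥ ω))))) := by
  have hn : 1 ≤ n := Nat.one_le_iff_ne_zero.mpr (NeZero.ne n)
  have hdet := (Matrix.isUnit_iff_isUnit_det _).mp (isUnit_DeltaA n hn M a ha)
  have hA : DeltaA n M a *ᵥ ((DeltaA n M a)⁻¹ *ᵥ (QvAdj n M *ᵥ ω)) = QvAdj n M *ᵥ ω := by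
    rw [Matrix.mulVec_mulVec, Matrix.mul_nonsing_inv _ hdet, Matrix.one_mulVec]
  have hAo := orthConst_of_DeltaA_eq n M a ha.ne' (orthConst_QvAdj n M hω) hA
  rw [eq177 n M a ha.le hA hAo, eq180_QvAdj n M a ha ω hω, ← PhiOp_mulVec, Phi176Inv_PhiOp_mulVec n M a ha,
    Matrix.mulVec_smul, Matrix.mulVec_smul, smul_sub]
  abel

/-- `QGQ*c = a⁻¹c` on a constant configuration (`Q*c = c`, (1.82) `Gc = a⁻¹c`, `Qc = c`).
[cite: Balaban1984PropagatorsI, (1.82) p.31, (1.74) p.30] -/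
theorem QGQ_constV (ha : 0 < a) (c : Fin d → ℂ) :
    QvOp n M *ᵥ ((DeltaA n M a)⁻¹ *ᵥ (QvAdj n M *ᵥ constV M c)) = (a : ℂ)⁻¹ • constV M c := by
  rw [QvAdj_constV, G_constV n M a ha, Matrix.mulVec_smul, QvOp_constV]

/-- the (1.99) right-hand side vanishes behind `∂₁*φ⁻¹` on constants: `∂₁*φ⁻¹c = 0`.
[cite: Balaban1984PropagatorsI, (1.76) p.30] -/
theorem divE_Phi176Inv_constV (ha : 0 ≤ a) (c : Fin d → ℂ) :
    (GradOp M 1)ᴴ *ᵥ (Phi176Inv n M a *ᵥ constV M c) = 0 := by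
  rw [Phi176Inv_constV n M a ha, divS_constV]

/-- **(1.99) on all of `ℓ²(T₁^{(k)}; ℂ^d)`**: `QGQ*ω = a⁻¹ω − a⁻¹φ⁻¹ω′ + a⁻¹φ⁻¹∂₁(∂₁*φ⁻¹∂₁)⁻¹∂₁*φ⁻¹ω`
with `ω = ω′ + ω₀` the p. 27 decomposition (on `ω₀` both sides are `a⁻¹ω₀`, (1.82)).
[cite: Balaban1984PropagatorsI, (1.99) p.34, (1.82) p.31] -/
theorem eq199_mulVec (ha : 0 < a) (ω : Tor M × Fin d → ℂ) :
    QvOp n M *ᵥ ((DeltaA n M a)⁻¹ *ᵥ (QvAdj n M *ᵥ ω))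
      = (a : ℂ)⁻¹ • ω - (a : ℂ)⁻¹ • (Phi176Inv n M a *ᵥ Bp M ω)
        + (a : ℂ)⁻¹ • (Phi176Inv n M a *ᵥ (GradOp M 1 *ᵥ (GPhiEInv n M a *ᵥ
            ((GradOp M 1)ᴴ *ᵥ (Phi176Inv n M a *ᵥ ω))))) := by
  have hsplit : ω = Bp M ω + B0 M ω := (Bp_add_B0 M ω).symm
  have h0 : QvOp n M *ᵥ ((DeltaA n M a)⁻¹ *ᵥ (QvAdj n M *ᵥ B0 M ω)) = (a : ℂ)⁻¹ • B0 M ω :=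
    QGQ_constV n M a ha _
  have hd0 : (GradOp M 1)ᴴ *ᵥ (Phi176Inv n M a *ᵥ B0 M ω) = 0 := divE_Phi176Inv_constV n M a ha.le _
  have hp := eq199_mulVec_of_orth n M a ha (Bp M ω) (orthConst_Bp M ω)
  have hlast : (GradOp M 1)ᴴ *ᵥ (Phi176Inv n M a *ᵥ ω) = (GradOp M 1)ᴴ *ᵥ (Phi176Inv n M a *ᵥ Bp M ω) := by
    conv_lhs => rw [hsplit]
    rw [Matrix.mulVec_add, Matrix.mulVec_add, hd0, add_zero]
  have hω1 : (a : ℂ)⁻¹ • ω = (a : ℂ)⁻¹ • Bp M ω + (a : ℂ)⁻¹ • B0 M ω := by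
    rw [← smul_add, Bp_add_B0]
  rw [hlast, hω1]
  conv_lhs => rw [hsplit]
  rw [Matrix.mulVec_add, Matrix.mulVec_add, Matrix.mulVec_add, hp, h0]
  abel

/-- **(1.99) as a matrix identity** on `ℓ²(T₁^{(k)}; ℂ^d)`, the printed `φ⁻¹` read as `φ⁻¹(I − P₀)` — the inverse of
the SUBSPACE operator φ of (1.76) («on the subspace … orthogonal to constant functions»), extended by `0` to the
constants: `QGQ* = a⁻¹I − a⁻¹φ⁻¹(I − P₀) + a⁻¹φ⁻¹∂₁(∂₁*φ⁻¹∂₁)⁻¹∂₁*φ⁻¹`.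
[cite: Balaban1984PropagatorsI, (1.99) p.34] -/
theorem eq199 (ha : 0 < a) :
    QvOp n M * (DeltaA n M a)⁻¹ * QvAdj n M
      = (a : ℂ)⁻¹ • (1 : Matrix (Tor M × Fin d) (Tor M × Fin d) ℂ)
        - (a : ℂ)⁻¹ • (Phi176Inv n M a * (1 - P0M M))
        + (a : ℂ)⁻¹ • (Phi176Inv n M a * GradOp M 1 * GPhiEInv n M a * (GradOp M 1)ᴴ * Phi176Inv n M a) := by
  refine ext_of_mulVec' fun ω => ?_
  simp only [Matrix.add_mulVec, Matrix.sub_mulVec, Matrix.smul_mulVec, Matrix.one_mulVec,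
    ← Matrix.mulVec_mulVec, Matrix.mul_sub, Matrix.mul_one]
  rw [P0M_mulVec, eq199_mulVec n M a ha ω, Bp, Matrix.mulVec_sub]

/-! ## §3 (1.100): `a⁻¹(φ − 1)φ⁻¹ ≤ QGQ* ≤ a⁻¹I` -/

/-- bridge: `Q(Δ_a)⁻¹Q* = B5QGQ171Unit.covB` (`Q* = n^d·Qᴴ`, `(Δ_a)⁻¹ = 𝒢` by `calG_eq_DeltaA_inv`).
[cite: Balaban1984PropagatorsI, (1.71) p.30] -/
theorem QGQ_eq_covB (hn : 1 ≤ n) (ha : 0 < a) :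
    QvOp n M * (DeltaA n M a)⁻¹ * QvAdj n M = covB n hn M a ha := by
  rw [covB, calG_eq_DeltaA_inv, QvAdj, Matrix.mul_smul]

/-- **(1.100), upper bound**: «QGQ* ≤ a⁻¹I» — the Löwner form `a⁻¹I − QGQ* ⪰ 0` of `B5QGQ171Unit.effOp_posSemidef`
(`a − a²QGQ* ⪰ 0`, proved there from `Δ_a ⪰ aQ*Q`). [cite: Balaban1984PropagatorsI, (1.100) p.34] -/
theorem ineq1100_upper (ha : 0 < a) :
    ((a : ℂ)⁻¹ • (1 : Matrix (Tor M × Fin d) (Tor M × Fin d) ℂ)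
      - QvOp n M * (DeltaA n M a)⁻¹ * QvAdj n M).PosSemidef := by
  have hn : 1 ≤ n := Nat.one_le_iff_ne_zero.mpr (NeZero.ne n)
  have ha' : (a : ℂ) ≠ 0 := by exact_mod_cast ha.ne'
  have h1 : (((a ^ 2)⁻¹ : ℝ) : ℂ) * (a : ℂ) = (a : ℂ)⁻¹ := by
    push_cast
    rw [pow_two, mul_inv, mul_assoc, inv_mul_cancel₀ ha', mul_one]
  have h2 : (((a ^ 2)⁻¹ : ℝ) : ℂ) * (a : ℂ) ^ 2 = 1 := by
    push_cast
    exact inv_mul_cancel₀ (pow_ne_zero 2 ha')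
  have e : (a : ℂ)⁻¹ • (1 : Matrix (Tor M × Fin d) (Tor M × Fin d) ℂ) - QvOp n M * (DeltaA n M a)⁻¹ * QvAdj n M
      = (((a ^ 2)⁻¹ : ℝ) : ℂ) • effOp n hn M a ha := by
    rw [QGQ_eq_covB n M a hn ha, effOp, smul_sub, smul_smul, smul_smul, h1, h2, one_smul]
  rw [e]
  exact posSemidef_real_smul (effOp_posSemidef n hn M a ha) (inv_nonneg.mpr (sq_nonneg a))

/-- `QGQ*` is Hermitian. [cite: Balaban1984PropagatorsI, Prop. 1.1 p.33 («G is a symmetric operator»), (1.71) p.30] -/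
theorem QGQ_isHermitian (ha : 0 < a) : (QvOp n M * (DeltaA n M a)⁻¹ * QvAdj n M).IsHermitian := by
  have hn : 1 ≤ n := Nat.one_le_iff_ne_zero.mpr (NeZero.ne n)
  rw [QGQ_eq_covB n M a hn ha]
  exact covB_isHermitian n hn M a ha

/-- `φ⁻¹P₀ = P₀` (`φ⁻¹` fixes constants). [cite: Balaban1984PropagatorsI, (1.76) p.30] -/
theorem Phi176Inv_mul_P0M (ha : 0 ≤ a) : Phi176Inv n M a * P0M M = P0M M := by
  refine ext_of_mulVec' fun ω => ?_
  rw [← Matrix.mulVec_mulVec, P0M_mulVec, B0, Phi176Inv_constV n M a ha]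

/-- the difference in the lower bound of (1.100), computed from (1.99):
`QGQ* − a⁻¹(φ − 1)φ⁻¹ = a⁻¹P₀ + a⁻¹(∂₁*φ⁻¹)ᴴ(∂₁*φ⁻¹∂₁)⁻¹(∂₁*φ⁻¹)` (`(φ − 1)φ⁻¹ = I − φ⁻¹`, `φ⁻¹P₀ = P₀`,
`(φ⁻¹)ᴴ = φ⁻¹`). [cite: Balaban1984PropagatorsI, (1.99)–(1.100) p.34] -/
theorem QGQ_sub_lower_eq (ha : 0 < a) :
    QvOp n M * (DeltaA n M a)⁻¹ * QvAdj n M - (a : ℂ)⁻¹ • ((Phi176 n M a - 1) * Phi176Inv n M a)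
      = (a : ℂ)⁻¹ • (P0M M
          + ((GradOp M 1)ᴴ * Phi176Inv n M a)ᴴ * GPhiEInv n M a * ((GradOp M 1)ᴴ * Phi176Inv n M a)) := by
  rw [eq199 n M a ha, Matrix.sub_mul, Matrix.one_mul, Phi176_mul_Phi176Inv n M a ha.le, Matrix.mul_sub,
    Matrix.mul_one, Phi176Inv_mul_P0M n M a ha.le, Matrix.conjTranspose_mul, Matrix.conjTranspose_conjTranspose,
    (Phi176Inv_isHermitian n M a).eq]
  simp only [smul_sub, smul_add, Matrix.mul_assoc]
  abel

/-- **(1.100), lower bound**: «a⁻¹(φ − 1)φ⁻¹ ≤ QGQ*» in the Löwner order — by `QGQ_sub_lower_eq` the difference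
is `a⁻¹` times the sum of the projection `P₀ ⪰ 0` and the Gram-type operator
`(∂₁*φ⁻¹)ᴴ(∂₁*φ⁻¹∂₁)⁻¹(∂₁*φ⁻¹) ⪰ 0`. [cite: Balaban1984PropagatorsI, (1.100) p.34] -/
theorem ineq1100_lower (ha : 0 < a) :
    (QvOp n M * (DeltaA n M a)⁻¹ * QvAdj n M
      - (a : ℂ)⁻¹ • ((Phi176 n M a - 1) * Phi176Inv n M a)).PosSemidef := by
  rw [QGQ_sub_lower_eq n M a ha, ← Complex.ofReal_inv]
  exact posSemidef_real_smul
    ((P0M_posSemidef M).add ((GPhiEInv_posSemidef n M a ha.le).conjTranspose_mul_mul_same _))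
    (inv_nonneg.mpr ha.le)

/-- **(1.100) assembled**: `a⁻¹(φ − 1)φ⁻¹ ≤ QGQ* ≤ a⁻¹I` (both Löwner inequalities).
[cite: Balaban1984PropagatorsI, (1.100) p.34] -/
theorem ineq1100 (ha : 0 < a) :
    (QvOp n M * (DeltaA n M a)⁻¹ * QvAdj n M
        - (a : ℂ)⁻¹ • ((Phi176 n M a - 1) * Phi176Inv n M a)).PosSemidef
      ∧ ((a : ℂ)⁻¹ • (1 : Matrix (Tor M × Fin d) (Tor M × Fin d) ℂ)
        - QvOp n M * (DeltaA n M a)⁻¹ * QvAdj n M).PosSemidef :=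
  ⟨ineq1100_lower n M a ha, ineq1100_upper n M a ha⟩

/-- (1.100) as inequalities of quadratic forms: `a⁻¹Re⟨ω,(φ − 1)φ⁻¹ω⟩ ≤ Re⟨ω, QGQ*ω⟩ ≤ a⁻¹‖ω‖²` for every `ω`
(unit-lattice scalar product (1.21) = the plain sum). [cite: Balaban1984PropagatorsI, (1.100) p.34] -/
theorem ineq1100_form (ha : 0 < a) (ω : Tor M × Fin d → ℂ) :
    (star ω ⬝ᵥ (((a : ℂ)⁻¹ • ((Phi176 n M a - 1) * Phi176Inv n M a)) *ᵥ ω)).re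
        ≤ (star ω ⬝ᵥ ((QvOp n M * (DeltaA n M a)⁻¹ * QvAdj n M) *ᵥ ω)).re
      ∧ (star ω ⬝ᵥ ((QvOp n M * (DeltaA n M a)⁻¹ * QvAdj n M) *ᵥ ω)).re
        ≤ a⁻¹ * (star ω ⬝ᵥ ω).re := by
  constructor
  · have h := (Complex.nonneg_iff.mp ((ineq1100_lower n M a ha).dotProduct_mulVec_nonneg ω)).1
    rw [Matrix.sub_mulVec, dotProduct_sub, Complex.sub_re] at h
    linarith
  · have h := (Complex.nonneg_iff.mp ((ineq1100_upper n M a ha).dotProduct_mulVec_nonneg ω)).1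
    rw [Matrix.sub_mulVec, dotProduct_sub, Complex.sub_re, Matrix.smul_mulVec, Matrix.one_mulVec,
      dotProduct_smul, smul_eq_mul, ← Complex.ofReal_inv, Complex.re_ofReal_mul] at h
    linarith

end Main

end

end Literature.MathematicalPhysics.QuantumFieldTheory.Balaban1983to89.B5Eq199QGQTorus
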